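import Mathlib
import Summits.RiemannHypothesis.RiemannHypothesis.Theorems.WeilFarFloorCoshSplitRH
import HarnessLib

/-!
# Polarization of the prime-shift form and of the increments (the bilinear toolkit of the cosh split)

Helper file (`--supports stmt-RiemannHypothesis-0098`, lead-track anchor: Weil-positivity window ladder, format-C far bound),
pure proofs, RH-free.  Seat rh-explicit-weil-1 gen12 (memo `run/shared/lean/pub/rh-explicit/rh-explicit-weil-1/FORMAT-K3.md` §13.5): stage 2a
of C-XIII″ under RH (the zero-energy refinement of the cosh split needs the CROSS TERMS of the anatomy along `u = cC + r`).

For real measurable bounded `u, v` vanishing off `[−b, b]`: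
* `primeShiftForm_add_add_primeShiftForm_sub` : `Q_b(u+v) + Q_b(u−v) = 2Q_b(u) + 2Q_b(v)` (parallelogram law);
* `primeShiftForm_add_smul`, `bilinear_eq_integral_primeShiftOp_mul`, `primeShiftForm_smul_add` : `Q_b(cf + r) = c²Q_b(f) + Q_b(r) + 2c∫ (T_b f)·r`
  with the PRIME-SHIFT OPERATOR `(T_b f)(x) = Σ_{log n<2b} (Λ(n)/√n)(f(x − log n) + f(x + log n))`;
* `abs_integral_mul_sub_le` : `|∫ F·v − τ∫ u·v| ≤ (∫_S (F − τu)²)^{1/2}(∫ v²)^{1/2}` for `v` vanishing off the measurable set `S` — with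
  `WeilFarFloorCoshCouplingRH` (`∫_{(−b,b)}(T_bC_b − (e^b+b)C_b)² ≤ Kb⁵‖C_b‖²` under RH) this bounds the coupling of the cosh profile;
* `integral_sq_shiftAdd_sub_add_add`, `abs_integral_sq_shiftAdd_sub_add_sub_le` : `D_t(u+v) + D_t(u−v) = 2D_t(u) + 2D_t(v)` and
  `|D_t(u+v) − D_t(u−v)| ≤ 2λD_t(u) + (2/λ)D_t(v)` for every `λ > 0` (so `|ARCH(u+v) − ARCH(u−v)| ≤ 2λ·ARCH(u) + (2/λ)·ARCH(v)`).
Standard axioms only.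
-/

set_option linter.dupNamespace false
set_option autoImplicit false

noncomputable section

open MeasureTheory Set Filter
open scoped Real Topology ArithmeticFunction.vonMangoldt

namespace Summit.RiemannHypothesis.RiemannHypothesis.Theorems.WeilFormatC

namespace FloorCoshSplit

open Literature.NumberTheory.LFunctions FloorSmoothing

variable {b : ℝ} {u v : ℝ → ℝ} {Cu Cv : ℝ}

/-! ## §1 Polarization of the prime-shift form -/

/-- The admissible class is closed under `u ± v` (with bound `Cu + Cv`). -/
theorem admissible_add (hu : Measurable u) (hv : Measurable v) (hCu : ∀ x, |u x| ≤ Cu) (hCv : ∀ x, |v x| ≤ Cv)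
    (hus : ∀ x, x ∉ Icc (-b) b → u x = 0) (hvs : ∀ x, x ∉ Icc (-b) b → v x = 0) (s : ℝ) :
    Measurable (fun x ↦ u x + s * v x) ∧ (∀ x, |u x + s * v x| ≤ Cu + |s| * Cv) ∧
      (∀ x, x ∉ Icc (-b) b → u x + s * v x = 0) := by
  refine ⟨hu.add (measurable_const.mul hv), fun x ↦ ?_, fun x hx ↦ by rw [hus x hx, hvs x hx, mul_zero, add_zero]⟩
  calc |u x + s * v x| ≤ |u x| + |s * v x| := abs_add_le _ _
    _ = |u x| + |s| * |v x| := by rw [abs_mul]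
    _ ≤ Cu + |s| * Cv := add_le_add (hCu x) (mul_le_mul_of_nonneg_left (hCv x) (abs_nonneg s))

/-- One shift correlation of `u + s·v`: `∫ (u+sv)(x−ℓ)(u+sv)(x) = ∫u(x−ℓ)u(x) + s(∫u(x−ℓ)v(x) + ∫v(x−ℓ)u(x)) + s²∫v(x−ℓ)v(x)`. -/
theorem integral_shift_mul_add (hu : Measurable u) (hv : Measurable v) (hCu : ∀ x, |u x| ≤ Cu) (hCv : ∀ x, |v x| ≤ Cv)
    (hus : ∀ x, x ∉ Icc (-b) b → u x = 0) (hvs : ∀ x, x ∉ Icc (-b) b → v x = 0) (s ℓ : ℝ) :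
    ∫ x, (u (x - ℓ) + s * v (x - ℓ)) * (u x + s * v x)
      = (∫ x, u (x - ℓ) * u x) + s * ((∫ x, u (x - ℓ) * v x) + ∫ x, v (x - ℓ) * u x)
        + s ^ 2 * ∫ x, v (x - ℓ) * v x := by
  have iuu : Integrable fun x ↦ u (x - ℓ) * u x := by
    simpa only [sub_zero] using integrable_shift_mul_shift_two hu hu hCu hCu hus ℓ 0
  have iuv : Integrable fun x ↦ u (x - ℓ) * v x := by
    simpa only [sub_zero] using integrable_shift_mul_shift_two hu hv hCu hCv hvs ℓ 0
  have ivu : Integrable fun x ↦ v (x - ℓ) * u x := by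
    simpa only [sub_zero] using integrable_shift_mul_shift_two hv hu hCv hCu hus ℓ 0
  have ivv : Integrable fun x ↦ v (x - ℓ) * v x := by
    simpa only [sub_zero] using integrable_shift_mul_shift_two hv hv hCv hCv hvs ℓ 0
  have e : ∀ x, (u (x - ℓ) + s * v (x - ℓ)) * (u x + s * v x)
      = u (x - ℓ) * u x + s * (u (x - ℓ) * v x + v (x - ℓ) * u x) + s ^ 2 * (v (x - ℓ) * v x) := fun x ↦ by ring
  simp_rw [e]
  rw [integral_add (f := fun x ↦ u (x - ℓ) * u x + s * (u (x - ℓ) * v x + v (x - ℓ) * u x))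
      (g := fun x ↦ s ^ 2 * (v (x - ℓ) * v x)) (iuu.add ((iuv.add ivu).const_mul s)) (ivv.const_mul _),
    integral_add (f := fun x ↦ u (x - ℓ) * u x) (g := fun x ↦ s * (u (x - ℓ) * v x + v (x - ℓ) * u x)) iuu
      ((iuv.add ivu).const_mul s),
    integral_const_mul, integral_const_mul, integral_add iuv ivu]

/-- **`Q_b(u + s·v) = Q_b(u) + s·B + s²·Q_b(v)`** with the bilinear term `B = Σ 2(Λ/√n)(∫u(x−ℓ)v(x) + ∫v(x−ℓ)u(x))`. -/
theorem primeShiftForm_add_smul (hu : Measurable u) (hv : Measurable v) (hCu : ∀ x, |u x| ≤ Cu) (hCv : ∀ x, |v x| ≤ Cv)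
    (hus : ∀ x, x ∉ Icc (-b) b → u x = 0) (hvs : ∀ x, x ∉ Icc (-b) b → v x = 0) (s : ℝ) :
    primeShiftForm b (fun x ↦ u x + s * v x)
      = primeShiftForm b u
        + s * ∑ n ∈ weilPrimeIndex b, 2 * ((Λ n : ℝ) / Real.sqrt n) *
            ((∫ x, u (x - Real.log n) * v x) + ∫ x, v (x - Real.log n) * u x)
        + s ^ 2 * primeShiftForm b v := by
  unfold primeShiftForm
  rw [Finset.mul_sum, Finset.mul_sum, ← Finset.sum_add_distrib, ← Finset.sum_add_distrib]
  refine Finset.sum_congr rfl fun n _ ↦ ?_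
  rw [integral_shift_mul_add hu hv hCu hCv hus hvs s (Real.log n)]
  ring

/-- **Parallelogram law**: `Q_b(u+v) + Q_b(u−v) = 2Q_b(u) + 2Q_b(v)`. -/
theorem primeShiftForm_add_add_primeShiftForm_sub (hu : Measurable u) (hv : Measurable v) (hCu : ∀ x, |u x| ≤ Cu)
    (hCv : ∀ x, |v x| ≤ Cv) (hus : ∀ x, x ∉ Icc (-b) b → u x = 0) (hvs : ∀ x, x ∉ Icc (-b) b → v x = 0) :
    primeShiftForm b (fun x ↦ u x + v x) + primeShiftForm b (fun x ↦ u x - v x)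
      = 2 * primeShiftForm b u + 2 * primeShiftForm b v := by
  have h1 := primeShiftForm_add_smul hu hv hCu hCv hus hvs 1
  have h2 := primeShiftForm_add_smul hu hv hCu hCv hus hvs (-1)
  simp only [one_mul, neg_one_mul, ← sub_eq_add_neg, one_pow, neg_one_sq] at h1 h2
  rw [h1, h2]; ring

/-- **The bilinear term is the prime-shift OPERATOR paired with `v`**:
`Σ_{log n<2b} 2(Λ/√n)(∫u(x−ℓ)v(x) + ∫v(x−ℓ)u(x)) = 2∫ (Σ (Λ/√n)(u(x − log n) + u(x + log n)))·v(x) dx`. -/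
theorem bilinear_eq_integral_primeShiftOp_mul (hu : Measurable u) (hv : Measurable v) (hCu : ∀ x, |u x| ≤ Cu)
    (hCv : ∀ x, |v x| ≤ Cv) (hvs : ∀ x, x ∉ Icc (-b) b → v x = 0) :
    ∑ n ∈ weilPrimeIndex b, 2 * ((Λ n : ℝ) / Real.sqrt n) *
        ((∫ x, u (x - Real.log n) * v x) + ∫ x, v (x - Real.log n) * u x)
      = 2 * ∫ x, (∑ n ∈ weilPrimeIndex b, (Λ n : ℝ) / Real.sqrt n *
          (u (x - Real.log n) + u (x + Real.log n))) * v x := by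
  have hterm : ∀ n : ℕ, Integrable fun x ↦ (Λ n : ℝ) / Real.sqrt n * (u (x - Real.log n) + u (x + Real.log n)) * v x := by
    intro n
    have i1 : Integrable fun x ↦ u (x - Real.log n) * v x := by
      simpa only [sub_zero] using integrable_shift_mul_shift_two hu hv hCu hCv hvs (Real.log n) 0
    have i2 : Integrable fun x ↦ u (x + Real.log n) * v x := by
      simpa only [sub_zero, sub_neg_eq_add] using integrable_shift_mul_shift_two hu hv hCu hCv hvs (-Real.log n) 0
    exact ((i1.add i2).const_mul ((Λ n : ℝ) / Real.sqrt n)).congr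
      (Eventually.of_forall fun x ↦ by simp only [Pi.add_apply]; ring)
  have hswap : ∀ n : ℕ, ∫ x, v (x - Real.log n) * u x = ∫ x, u (x + Real.log n) * v x := by
    intro n
    rw [← integral_sub_right_eq_self (fun x ↦ u (x + Real.log n) * v x) (Real.log n)]
    refine integral_congr_ae (Eventually.of_forall fun x ↦ ?_)
    simp only [sub_add_cancel, mul_comm]
  simp_rw [Finset.sum_mul]
  rw [integral_finsetSum _ (fun n _ ↦ hterm n), Finset.mul_sum]
  refine Finset.sum_congr rfl fun n _ ↦ ?_
  have i1 : Integrable fun x ↦ u (x - Real.log n) * v x := by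
    simpa only [sub_zero] using integrable_shift_mul_shift_two hu hv hCu hCv hvs (Real.log n) 0
  have i2 : Integrable fun x ↦ u (x + Real.log n) * v x := by
    simpa only [sub_zero, sub_neg_eq_add] using integrable_shift_mul_shift_two hu hv hCu hCv hvs (-Real.log n) 0
  have e : ∀ x, (Λ n : ℝ) / Real.sqrt n * (u (x - Real.log n) + u (x + Real.log n)) * v x
      = (Λ n : ℝ) / Real.sqrt n * (u (x - Real.log n) * v x + u (x + Real.log n) * v x) := fun x ↦ by ring
  simp_rw [e]
  rw [integral_const_mul, integral_add i1 i2, hswap]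
  ring

/-- `Q_b(c·f + r) = c²Q_b(f) + Q_b(r) + 2c∫(T_b f)·r`: the prime-shift form along a decomposition. -/
theorem primeShiftForm_smul_add {f r : ℝ → ℝ} {Cf Cr : ℝ} (hf : Measurable f) (hr : Measurable r)
    (hCf : ∀ x, |f x| ≤ Cf) (hCr : ∀ x, |r x| ≤ Cr) (hfs : ∀ x, x ∉ Icc (-b) b → f x = 0)
    (hrs : ∀ x, x ∉ Icc (-b) b → r x = 0) (c : ℝ) :
    primeShiftForm b (fun x ↦ c * f x + r x)
      = c ^ 2 * primeShiftForm b f + primeShiftForm b r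
        + 2 * c * ∫ x, (∑ n ∈ weilPrimeIndex b, (Λ n : ℝ) / Real.sqrt n *
            (f (x - Real.log n) + f (x + Real.log n))) * r x := by
  have h := primeShiftForm_add_smul hr hf hCr hCf hrs hfs c
  have e : (fun x ↦ r x + c * f x) = fun x ↦ c * f x + r x := funext fun x ↦ by ring
  rw [e] at h
  have hsym : ∑ n ∈ weilPrimeIndex b, 2 * ((Λ n : ℝ) / Real.sqrt n) *
        ((∫ x, r (x - Real.log n) * f x) + ∫ x, f (x - Real.log n) * r x)
      = ∑ n ∈ weilPrimeIndex b, 2 * ((Λ n : ℝ) / Real.sqrt n) *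
        ((∫ x, f (x - Real.log n) * r x) + ∫ x, r (x - Real.log n) * f x) :=
    Finset.sum_congr rfl fun n _ ↦ by ring
  rw [h, hsym, bilinear_eq_integral_primeShiftOp_mul hf hr hCf hCr hrs]
  ring

/-- **Cauchy–Schwarz for the coupling**: for measurable bounded `F`, `u` and an admissible `v` vanishing off `[−B, B]`,
`|∫ F·v − τ∫ u·v| ≤ (∫_{[−B,B]} (F − τu)²)^{1/2}·(∫ v²)^{1/2}`. -/
theorem abs_integral_mul_sub_le {F : ℝ → ℝ} {CF B : ℝ} (hF : Measurable F) (hCF : ∀ x, |F x| ≤ CF)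
    (hu : Measurable u) (hCu : ∀ x, |u x| ≤ Cu) (hv : Measurable v) (hCv : ∀ x, |v x| ≤ Cv)
    (hvs : ∀ x, x ∉ Icc (-B) B → v x = 0) (τ : ℝ) :
    |(∫ x, F x * v x) - τ * ∫ x, u x * v x|
      ≤ Real.sqrt (∫ x in Icc (-B) B, (F x - τ * u x) ^ 2) * Real.sqrt (∫ x, v x ^ 2) := by
  set G : ℝ → ℝ := fun x ↦ (Icc (-B) B).indicator (fun x ↦ F x - τ * u x) x with hG
  have hGm : Measurable G := (hF.sub (measurable_const.mul hu)).indicator measurableSet_Icc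
  have hbd : ∀ x, |F x - τ * u x| ≤ CF + |τ| * Cu := fun x ↦ by
    calc |F x - τ * u x| ≤ |F x| + |τ * u x| := abs_sub _ _
      _ = |F x| + |τ| * |u x| := by rw [abs_mul]
      _ ≤ CF + |τ| * Cu := add_le_add (hCF x) (mul_le_mul_of_nonneg_left (hCu x) (abs_nonneg τ))
  have hGb : ∀ x, |G x| ≤ CF + |τ| * Cu := fun x ↦ by
    by_cases hx : x ∈ Icc (-B) B
    · simp only [hG, indicator_of_mem hx]; exact hbd x
    · simp only [hG, indicator_of_notMem hx, abs_zero]; exact (abs_nonneg _).trans (hbd x)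
  have hGs : ∀ x, x ∉ Icc (-B) B → G x = 0 := fun x hx ↦ by simp only [hG, indicator_of_notMem hx]
  -- integrability
  have iGG : Integrable fun x ↦ G x ^ 2 := by
    have := integrable_shiftAdd_mul_shiftAdd hGm hGb hGs 0 0
    simp only [add_zero] at this
    exact this.congr (Eventually.of_forall fun x ↦ by simp only; ring)
  have ivv : Integrable fun x ↦ v x ^ 2 := by
    have := integrable_shiftAdd_mul_shiftAdd hv hCv hvs 0 0
    simp only [add_zero] at this
    exact this.congr (Eventually.of_forall fun x ↦ by simp only; ring)
  have iGv : Integrable fun x ↦ G x * v x := by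
    simpa only [sub_zero] using integrable_shift_mul_shift_two hGm hv hGb hCv hvs 0 0
  have iFv : Integrable fun x ↦ F x * v x := by
    simpa only [sub_zero] using integrable_shift_mul_shift_two hF hv hCF hCv hvs 0 0
  have iuv : Integrable fun x ↦ u x * v x := by
    simpa only [sub_zero] using integrable_shift_mul_shift_two hu hv hCu hCv hvs 0 0
  -- `∫ G v = ∫ F v − τ ∫ u v`
  have hGv : ∀ x, G x * v x = F x * v x - τ * (u x * v x) := fun x ↦ by
    by_cases hx : x ∈ Icc (-B) B
    · simp only [hG, indicator_of_mem hx]; ring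
    · rw [hvs x hx]; ring
  have hint : ∫ x, G x * v x = (∫ x, F x * v x) - τ * ∫ x, u x * v x := by
    simp_rw [hGv]
    rw [integral_sub iFv (iuv.const_mul τ), integral_const_mul]
  -- `∫ G² = ∫_{[−B,B]} (F − τu)²`
  have hGsq : ∫ x, G x ^ 2 = ∫ x in Icc (-B) B, (F x - τ * u x) ^ 2 := by
    have e : (fun x ↦ G x ^ 2) = (Icc (-B) B).indicator (fun x ↦ (F x - τ * u x) ^ 2) := by
      funext x
      by_cases hx : x ∈ Icc (-B) B
      · simp only [hG, indicator_of_mem hx]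
      · simp only [hG, indicator_of_notMem hx]; ring
    rw [e, integral_indicator measurableSet_Icc]
  -- Cauchy–Schwarz
  have hCS := sq_integral_mul_le iGG iGv ivv
  rw [← hint, ← hGsq, ← Real.sqrt_mul (integral_nonneg fun x ↦ sq_nonneg _)]
  exact Real.abs_le_sqrt hCS

/-! ## §2 Polarization of the increments -/

/-- **Parallelogram law for increments**: `D_t(u+v) + D_t(u−v) = 2D_t(u) + 2D_t(v)` (`D_t(w) = ∫(w(x+t) − w(x))²`). -/
theorem integral_sq_shiftAdd_sub_add_add (hu : Measurable u) (hv : Measurable v) (hCu : ∀ x, |u x| ≤ Cu)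
    (hCv : ∀ x, |v x| ≤ Cv) (hus : ∀ x, x ∉ Icc (-b) b → u x = 0) (hvs : ∀ x, x ∉ Icc (-b) b → v x = 0) (t : ℝ) :
    (∫ x, ((u (x + t) + v (x + t)) - (u x + v x)) ^ 2) + ∫ x, ((u (x + t) - v (x + t)) - (u x - v x)) ^ 2
      = 2 * (∫ x, (u (x + t) - u x) ^ 2) + 2 * ∫ x, (v (x + t) - v x) ^ 2 := by
  have iu := integrable_sq_shiftAdd_sub hu hCu hus t
  have iv := integrable_sq_shiftAdd_sub hv hCv hvs t
  -- the cross term is integrable (`|2ab| ≤ a² + b²`)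
  have hm : Measurable fun x ↦ (u (x + t) - u x) * (v (x + t) - v x) :=
    ((hu.comp (measurable_id.add_const t)).sub hu).mul ((hv.comp (measurable_id.add_const t)).sub hv)
  have iuv : Integrable fun x ↦ (u (x + t) - u x) * (v (x + t) - v x) := by
    refine Integrable.mono' ((iu.add iv).div_const 2) hm.aestronglyMeasurable (Eventually.of_forall fun x ↦ ?_)
    simp only [Real.norm_eq_abs, abs_mul, Pi.add_apply]
    nlinarith only [sq_nonneg (|u (x + t) - u x| - |v (x + t) - v x|), sq_abs (u (x + t) - u x), sq_abs (v (x + t) - v x),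
      abs_nonneg (u (x + t) - u x), abs_nonneg (v (x + t) - v x)]
  have e1 : ∀ x, ((u (x + t) + v (x + t)) - (u x + v x)) ^ 2
      = (u (x + t) - u x) ^ 2 + 2 * ((u (x + t) - u x) * (v (x + t) - v x)) + (v (x + t) - v x) ^ 2 := fun x ↦ by ring
  have e2 : ∀ x, ((u (x + t) - v (x + t)) - (u x - v x)) ^ 2
      = (u (x + t) - u x) ^ 2 - 2 * ((u (x + t) - u x) * (v (x + t) - v x)) + (v (x + t) - v x) ^ 2 := fun x ↦ by ring
  simp_rw [e1, e2]
  rw [integral_add (f := fun x ↦ (u (x + t) - u x) ^ 2 + 2 * ((u (x + t) - u x) * (v (x + t) - v x)))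
      (g := fun x ↦ (v (x + t) - v x) ^ 2) (iu.add (iuv.const_mul 2)) iv,
    integral_add (f := fun x ↦ (u (x + t) - u x) ^ 2) (g := fun x ↦ 2 * ((u (x + t) - u x) * (v (x + t) - v x))) iu
      (iuv.const_mul 2),
    integral_add (f := fun x ↦ (u (x + t) - u x) ^ 2 - 2 * ((u (x + t) - u x) * (v (x + t) - v x)))
      (g := fun x ↦ (v (x + t) - v x) ^ 2) (iu.sub (iuv.const_mul 2)) iv,
    integral_sub (f := fun x ↦ (u (x + t) - u x) ^ 2) (g := fun x ↦ 2 * ((u (x + t) - u x) * (v (x + t) - v x))) iu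
      (iuv.const_mul 2)]
  ring

/-- **The cross increments are controlled by the pure ones**: for every `λ > 0`,
`|D_t(u+v) − D_t(u−v)| ≤ 2λ·D_t(u) + (2/λ)·D_t(v)`. -/
theorem abs_integral_sq_shiftAdd_sub_add_sub_le (hu : Measurable u) (hv : Measurable v) (hCu : ∀ x, |u x| ≤ Cu)
    (hCv : ∀ x, |v x| ≤ Cv) (hus : ∀ x, x ∉ Icc (-b) b → u x = 0) (hvs : ∀ x, x ∉ Icc (-b) b → v x = 0)
    {lam : ℝ} (hlam : 0 < lam) (t : ℝ) :
    |(∫ x, ((u (x + t) + v (x + t)) - (u x + v x)) ^ 2) - ∫ x, ((u (x + t) - v (x + t)) - (u x - v x)) ^ 2|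
      ≤ 2 * lam * (∫ x, (u (x + t) - u x) ^ 2) + 2 / lam * ∫ x, (v (x + t) - v x) ^ 2 := by
  have iu := integrable_sq_shiftAdd_sub hu hCu hus t
  have iv := integrable_sq_shiftAdd_sub hv hCv hvs t
  obtain ⟨hpm, hpb, hps⟩ := admissible_add hu hv hCu hCv hus hvs 1
  obtain ⟨hmm, hmb, hms⟩ := admissible_add hu hv hCu hCv hus hvs (-1)
  have ip := integrable_sq_shiftAdd_sub hpm hpb hps t
  have im := integrable_sq_shiftAdd_sub hmm hmb hms t
  simp only [one_mul, neg_one_mul, ← sub_eq_add_neg] at ip im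
  rw [← integral_sub ip im]
  refine (abs_integral_le_integral_abs).trans ?_
  rw [← integral_const_mul, ← integral_const_mul, ← integral_add (iu.const_mul _) (iv.const_mul _)]
  refine integral_mono_of_nonneg (Eventually.of_forall fun x ↦ abs_nonneg _) ((iu.const_mul _).add (iv.const_mul _))
    (Eventually.of_forall fun x ↦ ?_)
  -- pointwise: `|(A+B)² − (A−B)²| = 4|AB| ≤ 2λA² + (2/λ)B²`
  dsimp only
  set A := u (x + t) - u x
  set B := v (x + t) - v x
  have e : ((u (x + t) + v (x + t)) - (u x + v x)) ^ 2 - ((u (x + t) - v (x + t)) - (u x - v x)) ^ 2 = 4 * (A * B) := by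
    simp only [A, B]; ring
  rw [e]
  have key : 4 * |A * B| ≤ 2 * lam * A ^ 2 + 2 / lam * B ^ 2 := by
    rw [abs_mul]
    have h1 : 0 ≤ (lam * |A| - |B|) ^ 2 := sq_nonneg _
    have e1 : (2 * lam * A ^ 2 + 2 / lam * B ^ 2) * lam = 2 * lam ^ 2 * A ^ 2 + 2 * B ^ 2 := by
      field_simp
    refine le_of_mul_le_mul_right ?_ hlam
    rw [e1]
    nlinarith only [h1, sq_abs A, sq_abs B]
  calc |4 * (A * B)| = 4 * |A * B| := by rw [abs_mul, abs_of_pos (by norm_num : (0 : ℝ) < 4)]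
    _ ≤ 2 * lam * A ^ 2 + 2 / lam * B ^ 2 := key

end FloorCoshSplit

end Summit.RiemannHypothesis.RiemannHypothesis.Theorems.WeilFormatC
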